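import Mathlib
import HarnessLib
import Summits.Ventures.LatticeQCDFlow.Scoring.GreenKuboDegenerateReversible
import Summits.Ventures.LatticeQCDFlow.Scoring.SUNWilsonForceHMCBatchMeans
import Summits.Ventures.LatticeQCDFlow.Exactness.GaugeFTHMCReversible

/-!
# THE ENGINE'S `SU(N)` HMC FOR THE WILSON ACTION HAS NO DEGENERATE OBSERVABLE: for every bounded
# measurable `f` on gauge configurations, `σ²_f = 0 ⟺ f = ⟨f⟩_β` Wilson-a.e. (every `β`, every torus,
# short trajectories `nε ≤ τ₀(N, d, β)`)

HONEST FRAMING: exact (Metropolis-corrected) sampling algorithms for lattice gauge theory;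
figures of merit are autocorrelation/cost numbers at stated couplings and volumes; no
continuum-physics claim.

Venture `LatticeQCDFlow` (cell pub-lqcd), topic `Scoring`; FANOUT row 8 (`s0-cpn-nemc`, GEN-23).
NEW WORK of the cell, not a published result; no definition is introduced; nothing is cited as a
fact.  The composition of three tree theorems: (i) the engine's periodic `SU(N)` leapfrog HMC with its
own Wilson force is REVERSIBLE for the Wilson measure at every `β, ε, nstep, L` (row 21's
`Exactness/EngineHMCReversible.wilsonForce_sunLeapfrogHMCN_isReversible`; re-derived here in three lines
from `Exactness/GaugeFTHMCReversible.hmc_config_isReversible` and the leapfrog proposal's involutivity /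
measure preservation of `Exactness/SUNMultiStepLeapfrogHMC`, so that this file does not wait for that
module's build); (ii) under the
short-trajectory condition `nstep · ε ≤ sunWilsonTrajThreshold N d β` it carries a Doeblin-power
certificate (`Scoring/SUNMultiStepLeapfrogHMCBatchMeans.sunLeapfrogHMCN_certificate` with the Wilson
force bounds of `Scoring/SUNWilsonForceHMCBatchMeans`), hence the geometric sup-norm envelope
(`Scoring/DoeblinPowerGeometricEnvelope.exists_geometricEnvelope_of_nHit`); (iii) a reversible kernel of
the envelope class has `σ²_f = 0 ⟺ f̄ = 0` a.e.
(`Scoring/GreenKuboDegenerateReversible.greenKubo_eq_zero_iff_centred_ae_eq_zero_of_isReversible`).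
CONSEQUENCE: the positivity hypothesis `σ²_f > 0` of the HMC arm's studentised CLT / exact-coverage
theorems (`Scoring/SUNWilsonForceHMCBatchMeans.wilsonForce_sunLeapfrogHMCN_batchMeans_coverage`,
`Scoring/SUNMultiStepLeapfrogHMCBatchMeans`) holds for EVERY bounded measurable observable that is not
Wilson-a.e. constant — plaquette, Wilson loops, Polyakov loops, topological densities — with no
further check.  Printed counterpart NAMED ONLY: positivity of the asymptotic variance of reversible
chains (Kipnis–Varadhan 1986; Geyer 1992) — nothing is cited as a fact.

## Content (`N ≥ 1`, dimension `d`, torus side `L ≥ 1`, any `β`, step `ε > 0`, `1 ≤ nstep`,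
## `nstep · ε ≤ sunWilsonTrajThreshold N d β`; `K` the engine's HMC kernel, `π_β` the Wilson measure)

* `wilsonForce_sunLeapfrogHMCN_isReversible'` — the arm is reversible for the Wilson measure;
* **`wilsonForce_sunLeapfrogHMCN_greenKubo_eq_zero_iff`** — for `|f| ≤ C` measurable:
  `σ²_f = 0 ↔ (f − ⟨f⟩_β) = 0` `π_β`-a.e.;
* **`wilsonForce_sunLeapfrogHMCN_greenKubo_pos`** — `¬((f − ⟨f⟩_β) = 0 a.e.) ⇒ 0 < σ²_f`.

NOT CLAIMED: long trajectories (`nε` above the threshold); OMF / jittered variants (their reversibility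
is in the tree, their certificate shape is the same — not instantiated here); any rate or constant; any
number of ours.
-/

noncomputable section

namespace Summit.Ventures.LatticeQCDFlow.Scoring

open MeasureTheory ProbabilityTheory Filter Finset Preorder Literature.Probability.MarkovChains
open Literature.MathematicalPhysics.QuantumFieldTheory
open Summit.Ventures.LatticeQCDFlow.Exactness
open scoped ENNReal Topology Matrix Matrix.Norms.Operator

set_option backward.isDefEq.respectTransparency false

section Wilson

variable (N : ℕ) [NeZero N] (d : ℕ) {L : ℕ} {ε : ℝ} {nstep : ℕ}

omit [NeZero N] in
/-- The periodic HMC arm as run is reversible for the Wilson measure (every `β`, `ε`, `nstep`, `L`) —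
the statement of row 21's `wilsonForce_sunLeapfrogHMCN_isReversible`, re-derived from
`hmc_config_isReversible`. -/
theorem wilsonForce_sunLeapfrogHMCN_isReversible' [NeZero L] (β ε : ℝ) (nstep : ℕ) :
    Kernel.IsReversible (sunLeapfrogHMCN (sunCoordι N) (sunCoordι_skew N) ε
        (Measure.addHaar : Measure (SUNCoords N)) (sunKinetic N)
        (measurable_halfKick_sun N (measurable_sunWilsonForce N (d := d) (L := L) β) ε)
        (fun U => β * wilsonAction (suRep N) U) nstep)
      (wilsonMeasure (d := d) (L := L) (suRep N) β) := by
  rw [← gibbsProbability_smul_wilsonAction_eq N (d := d) (L := L) (suRep N) β]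
  have hS : Measurable fun U : GaugeConfig d L (Matrix.specialUnitaryGroup (Fin N) ℂ) =>
      β * wilsonAction (suRep N) U := (continuous_smul_wilsonAction (suRep N) continuous_suRep β).measurable
  have hg := measurable_halfKick_sun N (measurable_sunWilsonForce N (d := d) (L := L) β) ε
  exact isReversible_smul (hmc_config_isReversible
    (vol := Measure.pi fun _ : Edge d L => haarProbability (Matrix.specialUnitaryGroup (Fin N) ℂ))
    (volP := Measure.pi fun _ : Edge d L => (Measure.addHaar : Measure (SUNCoords N)))
    (hΦ := measurable_sunLeapfrogProposalN (sunCoordι N) (sunCoordι_skew N) ε nstep hg) hS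
    (measurable_sunKinetic N) (involutive_sunLeapfrogProposalN (sunCoordι N) (sunCoordι_skew N) ε _ nstep)
    (measurePreserving_sunLeapfrogProposalN (sunCoordι N) (sunCoordι_skew N) ε nstep Measure.addHaar hg)) _

/-- **WILSON HMC: `σ²_f = 0 ⟺ f = ⟨f⟩_β` a.e.** (every `β`, every torus, `ε > 0`, `1 ≤ nstep`,
`nstep · ε ≤ sunWilsonTrajThreshold N d β`, `|f| ≤ C` measurable). -/
theorem wilsonForce_sunLeapfrogHMCN_greenKubo_eq_zero_iff [NeZero L] (β : ℝ) (hε : 0 < ε)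
    (hn : 1 ≤ nstep) (hτ : nstep * ε ≤ sunWilsonTrajThreshold N d β)
    {f : GaugeConfig d L (Matrix.specialUnitaryGroup (Fin N) ℂ) → ℝ} (hf : Measurable f) {C : ℝ}
    (hC : ∀ U, |f U| ≤ C)
    [hK : IsMarkovKernel (sunLeapfrogHMCN (sunCoordι N) (sunCoordι_skew N) ε
      (Measure.addHaar : Measure (SUNCoords N)) (sunKinetic N)
      (measurable_halfKick_sun N (measurable_sunWilsonForce N (d := d) (L := L) β) ε)
      (fun U => β * wilsonAction (suRep N) U) nstep)] :
    (∫ y, (f y - ∫ z, f z ∂(wilsonMeasure (d := d) (L := L) (suRep N) β)) ^ 2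
        ∂(wilsonMeasure (d := d) (L := L) (suRep N) β))
        + 2 * ∑' j, ∫ y, (f y - ∫ z, f z ∂(wilsonMeasure (d := d) (L := L) (suRep N) β))
          * (kop (sunLeapfrogHMCN (sunCoordι N) (sunCoordι_skew N) ε
              (Measure.addHaar : Measure (SUNCoords N)) (sunKinetic N)
              (measurable_halfKick_sun N (measurable_sunWilsonForce N (d := d) (L := L) β) ε)
              (fun U => β * wilsonAction (suRep N) U) nstep))^[j + 1]
            (fun y => f y - ∫ z, f z ∂(wilsonMeasure (d := d) (L := L) (suRep N) β)) y
          ∂(wilsonMeasure (d := d) (L := L) (suRep N) β) = 0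
      ↔ (fun y => f y - ∫ z, f z ∂(wilsonMeasure (d := d) (L := L) (suRep N) β))
          =ᵐ[wilsonMeasure (d := d) (L := L) (suRep N) β] 0 := by
  have hrev := wilsonForce_sunLeapfrogHMCN_isReversible' N d (L := L) β ε nstep
  obtain ⟨h1, h2, h3⟩ := trajLength_threshold_arith
    (sunShortTrajThreshold_pos (sunCoordι N) (sunCoordι_injective N))
    (sunWilsonForceSup_nonneg N d β) (sunWilsonForceLip_nonneg N d β) hn hε
    (rfl : sunWilsonTrajThreshold N d β = _) hτ
  obtain ⟨s, hs⟩ := exists_bound_smul_wilsonAction_sun N (d := d) (L := L) (suRep N) continuous_suRep β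
  rw [← gibbsProbability_smul_wilsonAction_eq N (d := d) (L := L) (suRep N) β] at hrev ⊢
  obtain ⟨hπ, m, ε', hm, hε0, hε1, hmin⟩ := sunLeapfrogHMCN_certificate N hε hn
    (measurable_halfKick_sun N (measurable_sunWilsonForce N β) ε) (halfKick_sunWilsonForce_nonneg N d β hε)
    (norm_halfKick_sunWilsonForce_le N d β hε) (halfKickLip_sunWilsonForce_nonneg N d β hε)
    (norm_halfKick_sunWilsonForce_sub_le N d β hε)
    ((continuous_smul_wilsonAction (suRep N) continuous_suRep β).measurable) hs h1 h2 h3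
  obtain ⟨hlo, hhi⟩ := gibbsWeight_pinched (L := Edge d L) (n := Fin N) hs
  haveI := isProbabilityMeasure_gibbsProbability
    (μ := Measure.pi fun _ : Edge d L => haarProbability (Matrix.specialUnitaryGroup (Fin N) ℂ))
    (Real.exp_pos (-s)) hlo hhi
  obtain ⟨A, ρ, -, hρ0, hρ1, henv⟩ :=
    exists_geometricEnvelope_of_nHit (Exactness.GeneralNCMC.minorised_setwise hmin) hε0 hε1 hm hπ
  exact greenKubo_eq_zero_iff_centred_ae_eq_zero_of_isReversible hrev henv hρ0 hρ1 hf hC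

/-- **WILSON HMC: every bounded observable that is not `⟨·⟩_β`-a.e. constant has `σ²_f > 0`** — the
positivity hypothesis of the arm's studentised CLT and exact-coverage theorems, discharged. -/
theorem wilsonForce_sunLeapfrogHMCN_greenKubo_pos [NeZero L] (β : ℝ) (hε : 0 < ε)
    (hn : 1 ≤ nstep) (hτ : nstep * ε ≤ sunWilsonTrajThreshold N d β)
    {f : GaugeConfig d L (Matrix.specialUnitaryGroup (Fin N) ℂ) → ℝ} (hf : Measurable f) {C : ℝ}
    (hC : ∀ U, |f U| ≤ C)
    (hne : ¬ ((fun y => f y - ∫ z, f z ∂(wilsonMeasure (d := d) (L := L) (suRep N) β))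
          =ᵐ[wilsonMeasure (d := d) (L := L) (suRep N) β] 0))
    [hK : IsMarkovKernel (sunLeapfrogHMCN (sunCoordι N) (sunCoordι_skew N) ε
      (Measure.addHaar : Measure (SUNCoords N)) (sunKinetic N)
      (measurable_halfKick_sun N (measurable_sunWilsonForce N (d := d) (L := L) β) ε)
      (fun U => β * wilsonAction (suRep N) U) nstep)] :
    0 < (∫ y, (f y - ∫ z, f z ∂(wilsonMeasure (d := d) (L := L) (suRep N) β)) ^ 2
        ∂(wilsonMeasure (d := d) (L := L) (suRep N) β))
        + 2 * ∑' j, ∫ y, (f y - ∫ z, f z ∂(wilsonMeasure (d := d) (L := L) (suRep N) β))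
          * (kop (sunLeapfrogHMCN (sunCoordι N) (sunCoordι_skew N) ε
              (Measure.addHaar : Measure (SUNCoords N)) (sunKinetic N)
              (measurable_halfKick_sun N (measurable_sunWilsonForce N (d := d) (L := L) β) ε)
              (fun U => β * wilsonAction (suRep N) U) nstep))^[j + 1]
            (fun y => f y - ∫ z, f z ∂(wilsonMeasure (d := d) (L := L) (suRep N) β)) y
          ∂(wilsonMeasure (d := d) (L := L) (suRep N) β) := by
  have hrev := wilsonForce_sunLeapfrogHMCN_isReversible' N d (L := L) β ε nstep
  obtain ⟨h1, h2, h3⟩ := trajLength_threshold_arith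
    (sunShortTrajThreshold_pos (sunCoordι N) (sunCoordι_injective N))
    (sunWilsonForceSup_nonneg N d β) (sunWilsonForceLip_nonneg N d β) hn hε
    (rfl : sunWilsonTrajThreshold N d β = _) hτ
  obtain ⟨s, hs⟩ := exists_bound_smul_wilsonAction_sun N (d := d) (L := L) (suRep N) continuous_suRep β
  rw [← gibbsProbability_smul_wilsonAction_eq N (d := d) (L := L) (suRep N) β] at hrev hne ⊢
  obtain ⟨hπ, m, ε', hm, hε0, hε1, hmin⟩ := sunLeapfrogHMCN_certificate N hε hn
    (measurable_halfKick_sun N (measurable_sunWilsonForce N β) ε) (halfKick_sunWilsonForce_nonneg N d β hε)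
    (norm_halfKick_sunWilsonForce_le N d β hε) (halfKickLip_sunWilsonForce_nonneg N d β hε)
    (norm_halfKick_sunWilsonForce_sub_le N d β hε)
    ((continuous_smul_wilsonAction (suRep N) continuous_suRep β).measurable) hs h1 h2 h3
  obtain ⟨hlo, hhi⟩ := gibbsWeight_pinched (L := Edge d L) (n := Fin N) hs
  haveI := isProbabilityMeasure_gibbsProbability
    (μ := Measure.pi fun _ : Edge d L => haarProbability (Matrix.specialUnitaryGroup (Fin N) ℂ))
    (Real.exp_pos (-s)) hlo hhi
  obtain ⟨A, ρ, -, hρ0, hρ1, henv⟩ :=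
    exists_geometricEnvelope_of_nHit (Exactness.GeneralNCMC.minorised_setwise hmin) hε0 hε1 hm hπ
  exact greenKubo_pos_of_not_centred_ae_eq_zero_of_isReversible hrev henv hρ0 hρ1 hf hC hne

end Wilson

end Summit.Ventures.LatticeQCDFlow.Scoring

end
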